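import Literature.MathematicalPhysics.QuantumFieldTheory.Balaban1983to89.B9Eq325ProjFormula

/-!
# `Balaban1983to89.B9Eq325RLipschitzSqrt` — T. Bałaban, *Propagators for lattice gauge theories in a background field*, Commun. Math. Phys.
# **99** (1985) 389–434 [Balaban1985BackgroundPropagators] p. 403 with (3.21)∕(3.25) p. 394: **THE `κ^{−1∕2}` ROAD TO «R(U), P(U) = I − R(U) …
# SATISFY THE SAME BOUNDS» — `‖R(U)f − R(V)f‖ ≤ δ_A·(1∕(√κ₀ − δ_A) + 1∕√κ₀)·‖f‖`, `δ_A = θ_G M_Q + g θ_Q`, FIRST ORDER IN THE GENERATORS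
# `G′Q̃′†` OF THE COMPLEMENT OF `R`'s RANGE AND `κ₀^{−1∕2}` (NOT `κ₀⁻²`) IN THE FLAT COERCIVITY OF `Q̃′G′²Q̃′†`, WITH THE WINDOW `δ_A < √κ₀` ON THE
# GENERATORS (NOT a Weyl window `δ_K < κ₀` on the Gram operator)** — an alternative to S3d's telescoping of `(Q′G′²Q′*)⁻¹` for route R2′ STEP
# B7′ of the pub-balaban NE9 chain

statement-level skeleton of published theorems with citation tags; proofs where landed; nothing here is a claim about the Yang–Mills mass gap

CITATION HEADER (lean-in-tree rule).  Audit cell `pub-balaban`, sub-cell `t4`, BINDER row NE9; filed by NE9 formalisation-swarm LEAF PROVER 01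
(`b2b-balaban-t4-ne9-formalise-leaf-01`, gen 79), author lineage of the flat `κ(1)` (`B9Eq365QGGQLowerVariational` ∕ `…Sharp`), on the
numbers of record of 2026-08-22 (ne9-leaf-06 g64 W-1 l.46729 ∕ A-5 l.46858; t4-ne9-idea-1 g87 RESULT l.46797; this lineage l.46789 ∕ l.46898):
with the TRUE flat constant `κ(1) ≈ 3–5·10⁻⁴` (d = 4) the closed letter `C_R♯ ∝ κ⁻²` of S3d (`B9Eq325RLipschitzResolvent` ∕ `…Closed`) needs
`α ≲ 5·10⁻⁸`; this lineage's located remark (l.46789: «`R` is an ORTHOGONAL projection, so its Lipschitz constant should cost `κ^{−1∕2}`, not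
`κ⁻²`») is made a theorem here.  Source READ in the held text layer (`paper:balaban1985-cmp99-background-propagators`): p. 394 (3.21) *«R is the
orthogonal projection onto Δ^η_U N(Q′)»*, (3.25) *«Rf = (I − G′Q′*(Q′G′²Q′*)⁻¹Q′G′)f»*, p. 403 *«the operators R(U), P(U) = I − R(U) … satisfy the
same bounds»* — print asserts the bounds without a displayed road; (3.63)–(3.68) pp. 402–403 are the resolvent expansions of `G′(U)`.

THE DEVICE ([folklore] Hilbert-space geometry).  `R_i` = orthogonal projection onto `K_i`, and `K_iᗮ = range A_i` for linear `A_i : F → E` with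
`s_i‖x‖ ≤ ‖A_i x‖`.  Then `R₁ − R₂ = R₁(1 − R₂) − (1 − R₁)R₂` and BOTH pieces are first order in `A₁ − A₂`: `(1 − R₂)v = A₂y` gives
`‖R₁(A₂y)‖ = ‖R₁(A₂y − A₁y)‖ ≤ δ‖y‖ ≤ (δ∕s₂)‖v‖`; `(1 − R₁)(R₂v) = A₁x ⊥ R₁R₂v` gives `‖A₁x‖² = re⟪A₁x − A₂x, R₂v⟫ ≤ δ‖x‖‖v‖ ≤ (δ∕s₁)‖A₁x‖‖v‖`.
No pseudo-inverse, no principal angles, no equal-rank argument; `s₁ = s₂ − δ` by the triangle inequality (Weyl for the smallest singular value of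
the GENERATOR).  For the chain: `K_U = Δ_U N(Q′(U))` (the tree's `B11Eq103H1Complex.projR`, i.e. `B9Eq326OperatorAssembly.RofU`, IS Mathlib's
`Submodule.starProjection` of that subspace), `A_U = G′(U)Q̃′(U)†` (S3a `B9Eq325ProjFormula`: `RofU_eq_formula`, `inner_formula_rem_eq_zero`),
`s_V² = κ₀` = the flat coercivity IN FORM (`inner_qggq_eq`: `re⟪x, Q̃′G′²Q̃′†x⟫ = ‖G′Q̃′†x‖²`).

WHAT IS PROVED (sorry-free; 0 `def`; axioms standard; nothing of [B9] asserted as printed).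
* §1 ABSTRACT (`RCLike 𝕜`): `coercive_of_near_map` (`s‖x‖ ≤ ‖Ax‖`, `‖Ax − Bx‖ ≤ δ‖x‖ ⇒ (s−δ)‖x‖ ≤ ‖Bx‖`), `sqrt_mul_norm_le`,
  **`norm_starProjection_sub_le_of_generators`** (`‖R₁v − R₂v‖ ≤ (δ∕s₁ + δ∕s₂)‖v‖` from `A_i x ∈ K_iᗮ`, `v − R_iv ∈ range A_i`, `s_i‖x‖ ≤ ‖A_ix‖`,
  `‖A₁x − A₂x‖ ≤ δ‖x‖`), `norm_adjoint_apply_le` (`‖Tv‖ ≤ C‖v‖ ⇒ ‖T†w‖ ≤ C‖w‖`), **`norm_starProjection_sub_le_of_letters`** (`A_i = G_i ∘ q_i†`;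
  letters `θ_G, M_Q, θ_Q, g`, Gram-side `κ₀`; window `δ_A := θ_G M_Q + g θ_Q < √κ₀`; bound `δ_A(1∕(√κ₀ − δ_A) + 1∕√κ₀)`).
* §2 CHAIN: **`GQ_mem_orthogonal_and_gen`** (`G′(U)Q̃′(U)†x ⊥ Δ_U N(Q′(U))` and `f − R(U)f ∈ range(G′(U)Q̃′(U)†)`, from S3a);
  **`norm_RofU_sub_RofU_le_sqrt`** — for two backgrounds `U, V` with mutually adjoint transporters and the displayed positivities of `Δ′_{a′}`:
  from `hκ : ∀ ψ, κ₀‖ψ‖² ≤ re⟪ψ, Q̃′(V)G′(V)²Q̃′(V)†ψ⟫` (AT THE REFERENCE `V` ONLY — e.g. NE9 leaf-01's flat certificate at `V = 1`),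
  `‖G′(U)y − G′(V)y‖ ≤ θ_G‖y‖` (ne9-leaf-06's `B9Eq364GreenLipschitzForm`), `‖Q̃′(U)v‖ ≤ M_Q‖v‖`, `‖Q̃′(U)v − Q̃′(V)v‖ ≤ θ_Q‖v‖` (ne9-leaf-03's
  `Q̃′` letters), `‖G′(V)y‖ ≤ g‖y‖` and the window `θ_G M_Q + g θ_Q < √κ₀`:
  `‖R(U)f − R(V)f‖ ≤ ((θ_G M_Q + g θ_Q)∕(√κ₀ − (θ_G M_Q + g θ_Q)) + (θ_G M_Q + g θ_Q)∕√κ₀)·‖f‖`.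
NUMBERS (orientation, ne9-leaf-06 g64's diagonal letters at d = 4, a′ = 1, K = 2: `θ_G ≈ 320α`, `M_Q ≈ 1`, `θ_Q ≈ 8α`, `g = γ⁻¹ ≈ 4`, and
`κ₀ = 1.42·10⁻⁴` from `…Sharp`): `δ_A ≈ 352α`, window `α < 3.4·10⁻⁵` (S3d∕Closed: `α < 5·10⁻⁸`), `C_R ≈ 6·10⁴·α` for `α ≪ 10⁻⁵` (Closed: `≈ 2·10¹²·α`)
— floats on displayed closed forms, not certified, not a claim of this file.
HONEST SCOPE.  A composition file at the letters' level (the letters are NOT discharged here — that is the job of a closure twin of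
`B9Eq325RLipschitzClosed` with `norm_RofU_sub_RofU_le_sqrt` in place of `norm_RofU_sub_RofU_le`; first refusal ne9-leaf-06); NOT NE9, NOT the route
(cell pub-balaban: NE9 NOT PRINTED ∕ NOT PROVED; «NE9 ⇐ the named binders»; row WALLED ON A MODEL (O-NE9-1; #5 UNRULED); spine PROVED 0∕9; rung (B)+1
on a finite T⁴ — NOT infinite volume, NOT mass gap, NOT Clay; HONEST DEPENDENCY: continuum YM on T⁴ ⇐ BetaPertH ∧ nine spine estimates (0/9 proved);
BetaPertH ⇐ (D1) ∧ (D4) ∧ CAP+tail; G-an2-4 gates asym, D1 and NE2/3/4).  NEW file importing `B9Eq325ProjFormula` (ne9-leaf-06 g63, S3a) only;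
nothing modified.  Net new unproved facts: 0.
-/

noncomputable section

open scoped InnerProductSpace ComplexConjugate BigOperators

namespace Literature.MathematicalPhysics.QuantumFieldTheory.Balaban1983to89.B9Eq325RLipschitzSqrt

open B4Sect5Torus (TSite)
open B9SectCLatticeCarrier (Bond)
open B9Eq311L2Pairing (WL2)
open B9Eq319QprimeTorus (fineP)
open B11Eq103H1Complex (SiteL2K projR greenK apply_greenK covLaplaceSiteK)
open B9Eq310HessianOperator (adTransportW)
open B9Eq326OperatorAssembly (QprimeW RofU)
open B9Eq3119DeltaPiCarrier (laplacePrimeA laplacePrimeA_apply_of_ker GpOfU)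
open B9Eq325ProjFormula (inner_formula_rem_eq_zero inner_qggq_eq laplacePrimeA_isSymmetric QGGQ_pos RofU_eq_formula)

/-! ## §1 Two orthogonal projections generated by near, coercive maps differ by `δ(1∕s₁ + 1∕s₂)` (abstract, `RCLike`) -/

section Abstract

variable {𝕜 : Type*} [RCLike 𝕜] {E : Type*} [NormedAddCommGroup E] [InnerProductSpace 𝕜 E]
  {F : Type*} [NormedAddCommGroup F] [InnerProductSpace 𝕜 F]

/-- coercivity passes to a near map: `s‖x‖ ≤ ‖Ax‖` and `‖Ax − Bx‖ ≤ δ‖x‖` give `(s − δ)‖x‖ ≤ ‖Bx‖` (Weyl for the smallest singular value —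
first order in the perturbation of the GENERATOR, not of the Gram operator). [folklore] [cite: Balaban1985BackgroundPropagators, (3.65)–(3.67) p.403] -/
theorem coercive_of_near_map (A B : F →ₗ[𝕜] E) {s δ : ℝ} (hco : ∀ x, s * ‖x‖ ≤ ‖A x‖) (hdiff : ∀ x, ‖A x - B x‖ ≤ δ * ‖x‖) (x : F) :
    (s - δ) * ‖x‖ ≤ ‖B x‖ := by
  -- `‖Ax‖ − ‖Bx‖ ≤ ‖Ax − Bx‖`
  nlinarith [hco x, hdiff x, norm_sub_norm_le (A x) (B x)]

/-- from a coercive GRAM form to a coercive map: `κ‖x‖² ≤ ‖Ax‖²` with `0 ≤ κ` gives `√κ·‖x‖ ≤ ‖Ax‖`. [folklore]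
[cite: Balaban1985BackgroundPropagators, Thm 3.11 p.416] -/
theorem sqrt_mul_norm_le (A : F →ₗ[𝕜] E) {κ : ℝ} (hκ : 0 ≤ κ) (hco : ∀ x, κ * ‖x‖ ^ 2 ≤ ‖A x‖ ^ 2) (x : F) :
    Real.sqrt κ * ‖x‖ ≤ ‖A x‖ := by
  have h1 : (Real.sqrt κ * ‖x‖) ^ 2 ≤ ‖A x‖ ^ 2 := by rw [mul_pow, Real.sq_sqrt hκ]; exact hco x
  exact (pow_le_pow_iff_left₀ (by positivity) (norm_nonneg _) two_ne_zero).1 h1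

/-- **TWO ORTHOGONAL PROJECTIONS WHOSE COMPLEMENTS ARE GENERATED BY NEAR, COERCIVE MAPS ARE NEAR — FIRST ORDER IN THE GENERATORS, `1∕s` IN THE
COERCIVITY**: let `R_i` be the orthogonal projection onto `K_i` (`i = 1, 2`) and `A_i : F → E` linear maps with `A_i x ⊥ K_i`, `v − R_i v ∈ range A_i`
(i.e. `range A_i = K_iᗮ`), `s_i‖x‖ ≤ ‖A_i x‖` (`s_i > 0`) and `‖A₁x − A₂x‖ ≤ δ‖x‖`; then `‖R₁v − R₂v‖ ≤ (δ∕s₁ + δ∕s₂)‖v‖`.  (Write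
`Q_i = 1 − R_i`; `Q₁v − Q₂v = Q₁(R₂v) − R₁(Q₂v)`; `Q₂v = A₂y` so `‖R₁(A₂y)‖ = ‖R₁(A₂y − A₁y)‖ ≤ δ‖y‖ ≤ (δ∕s₂)‖Q₂v‖`; `Q₁(R₂v) = A₁x` is orthogonal to
`R₁R₂v`, so `‖A₁x‖² = re⟪A₁x − A₂x, R₂v⟫ ≤ δ‖x‖‖v‖ ≤ (δ∕s₁)‖A₁x‖‖v‖`.)  This is the `κ^{−1∕2}` road to [B9] p. 403's «R(U), P(U) = I − R(U) …
satisfy the same bounds»: with `A = G′Q′*`, `s² = ` the coercivity of `Q′G′²Q′*`. [folklore] [cite: Balaban1985BackgroundPropagators, (3.25) p.394, p.403, (3.65)–(3.67) p.403] -/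
theorem norm_starProjection_sub_le_of_generators (K₁ K₂ : Submodule 𝕜 E) [K₁.HasOrthogonalProjection] [K₂.HasOrthogonalProjection]
    (A₁ A₂ : F →ₗ[𝕜] E) {s₁ s₂ δ : ℝ} (hs₁ : 0 < s₁) (hs₂ : 0 < s₂) (hδ : 0 ≤ δ)
    (horth₁ : ∀ x, A₁ x ∈ K₁ᗮ) (horth₂ : ∀ x, A₂ x ∈ K₂ᗮ)
    (hgen₁ : ∀ v, ∃ x, v - K₁.starProjection v = A₁ x) (hgen₂ : ∀ v, ∃ x, v - K₂.starProjection v = A₂ x)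
    (hco₁ : ∀ x, s₁ * ‖x‖ ≤ ‖A₁ x‖) (hco₂ : ∀ x, s₂ * ‖x‖ ≤ ‖A₂ x‖) (hdiff : ∀ x, ‖A₁ x - A₂ x‖ ≤ δ * ‖x‖) (v : E) :
    ‖K₁.starProjection v - K₂.starProjection v‖ ≤ (δ / s₁ + δ / s₂) * ‖v‖ := by
  -- the two pieces: `w = R₂v ∈ K₂`, `u = v − R₂v = A₂ y`
  set w : E := K₂.starProjection v with hw
  have hwK : w ∈ K₂ := K₂.starProjection_apply_mem v
  obtain ⟨y, hy⟩ := hgen₂ v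
  have hwn : ‖w‖ ≤ ‖v‖ := K₂.norm_starProjection_apply_le v
  have hun : ‖v - w‖ ≤ ‖v‖ := by rw [hw, ← Submodule.starProjection_orthogonal_val]; exact K₂ᗮ.norm_starProjection_apply_le v
  -- TERM 2: `‖R₁(A₂y)‖ ≤ ‖A₂y − A₁y‖ ≤ δ‖y‖ ≤ (δ/s₂)‖A₂y‖`
  have hT2 : ‖K₁.starProjection (v - w)‖ ≤ δ / s₂ * ‖v‖ := by
    rw [hy]
    have h1 : K₁.starProjection (A₂ y) = K₁.starProjection (A₂ y - A₁ y) := by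
      rw [map_sub, (Submodule.starProjection_apply_eq_zero_iff K₁).2 (horth₁ y), sub_zero]
    rw [h1]
    calc ‖K₁.starProjection (A₂ y - A₁ y)‖ ≤ ‖A₂ y - A₁ y‖ := K₁.norm_starProjection_apply_le _
      _ ≤ δ * ‖y‖ := by rw [norm_sub_rev]; exact hdiff y
      _ ≤ δ * (‖A₂ y‖ / s₂) := by
          refine mul_le_mul_of_nonneg_left ?_ hδ
          rw [le_div_iff₀ hs₂, mul_comm]; exact hco₂ y
      _ = δ / s₂ * ‖A₂ y‖ := by ring
      _ ≤ δ / s₂ * ‖v‖ := by rw [← hy]; exact mul_le_mul_of_nonneg_left hun (by positivity)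
  -- TERM 1: `w − R₁w = A₁x ∈ K₁ᗮ`, `‖A₁x‖² = re⟪A₁x, w⟫ = re⟪A₁x − A₂x, w⟫ ≤ δ‖x‖‖w‖ ≤ (δ/s₁)‖A₁x‖‖w‖`
  have hT1 : ‖w - K₁.starProjection w‖ ≤ δ / s₁ * ‖v‖ := by
    obtain ⟨x, hx⟩ := hgen₁ w
    rw [hx]
    have h1 : ‖A₁ x‖ ^ 2 = RCLike.re ⟪A₁ x, w⟫_𝕜 := by
      have e : w = A₁ x + K₁.starProjection w := by rw [← hx]; abel
      conv_rhs => rw [e]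
      rw [inner_add_right, map_add, Submodule.inner_left_of_mem_orthogonal (K₁.starProjection_apply_mem w) (horth₁ x), map_zero, add_zero,
        inner_self_eq_norm_sq (𝕜 := 𝕜)]
    have h2 : ⟪A₂ x, w⟫_𝕜 = 0 := Submodule.inner_left_of_mem_orthogonal hwK (horth₂ x)
    have h3 : RCLike.re ⟪A₁ x, w⟫_𝕜 = RCLike.re ⟪A₁ x - A₂ x, w⟫_𝕜 := by
      rw [inner_sub_left, h2, sub_zero]
    have h4 : ‖A₁ x‖ ^ 2 ≤ δ / s₁ * ‖A₁ x‖ * ‖w‖ := by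
      rw [h1, h3]
      calc RCLike.re ⟪A₁ x - A₂ x, w⟫_𝕜 ≤ ‖⟪A₁ x - A₂ x, w⟫_𝕜‖ := RCLike.re_le_norm _
        _ ≤ ‖A₁ x - A₂ x‖ * ‖w‖ := norm_inner_le_norm _ _
        _ ≤ δ * ‖x‖ * ‖w‖ := mul_le_mul_of_nonneg_right (hdiff x) (norm_nonneg _)
        _ ≤ δ * (‖A₁ x‖ / s₁) * ‖w‖ := by
            refine mul_le_mul_of_nonneg_right (mul_le_mul_of_nonneg_left ?_ hδ) (norm_nonneg _)
            rw [le_div_iff₀ hs₁, mul_comm]; exact hco₁ x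
        _ = δ / s₁ * ‖A₁ x‖ * ‖w‖ := by ring
    by_cases h0 : A₁ x = 0
    · rw [h0, norm_zero]; positivity
    · have hpos : 0 < ‖A₁ x‖ := norm_pos_iff.2 h0
      have h5 : ‖A₁ x‖ * ‖A₁ x‖ ≤ (δ / s₁ * ‖w‖) * ‖A₁ x‖ := by nlinarith
      have h6 := le_of_mul_le_mul_right h5 hpos
      exact h6.trans (mul_le_mul_of_nonneg_left hwn (by positivity))
  -- assemble: `R₁v − R₂v = R₁(v − w) − (w − R₁w)`
  have e : K₁.starProjection v - K₂.starProjection v = K₁.starProjection (v - w) - (w - K₁.starProjection w) := by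
    rw [map_sub, hw]; abel
  rw [e]
  calc ‖K₁.starProjection (v - w) - (w - K₁.starProjection w)‖
      ≤ ‖K₁.starProjection (v - w)‖ + ‖w - K₁.starProjection w‖ := norm_sub_le _ _
    _ ≤ δ / s₂ * ‖v‖ + δ / s₁ * ‖v‖ := add_le_add hT2 hT1
    _ = (δ / s₁ + δ / s₂) * ‖v‖ := by ring

variable [FiniteDimensional 𝕜 E] [FiniteDimensional 𝕜 F]

/-- a pointwise operator bound passes to the Hilbert adjoint: `‖Tv‖ ≤ C‖v‖` for all `v` gives `‖T†w‖ ≤ C‖w‖` for all `w`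
(`‖T†w‖² = re⟪TT†w, w⟫ ≤ C‖T†w‖‖w‖`). [folklore] [cite: Balaban1985BackgroundPropagators, (3.19) p.393, (3.63) p.402] -/
theorem norm_adjoint_apply_le (T : F →ₗ[𝕜] E) {C : ℝ} (hC : 0 ≤ C) (hT : ∀ v, ‖T v‖ ≤ C * ‖v‖) (w : E) :
    ‖LinearMap.adjoint T w‖ ≤ C * ‖w‖ := by
  set u := LinearMap.adjoint T w with hu
  have h1 : ‖u‖ ^ 2 = RCLike.re ⟪T u, w⟫_𝕜 := by
    rw [← LinearMap.adjoint_inner_right, ← hu, inner_self_eq_norm_sq (𝕜 := 𝕜)]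
  have h2 : ‖u‖ ^ 2 ≤ C * ‖u‖ * ‖w‖ := by
    rw [h1]
    calc RCLike.re ⟪T u, w⟫_𝕜 ≤ ‖⟪T u, w⟫_𝕜‖ := RCLike.re_le_norm _
      _ ≤ ‖T u‖ * ‖w‖ := norm_inner_le_norm _ _
      _ ≤ C * ‖u‖ * ‖w‖ := mul_le_mul_of_nonneg_right (hT u) (norm_nonneg _)
  by_cases h0 : u = 0
  · rw [h0, norm_zero]; positivity
  · have hpos : 0 < ‖u‖ := norm_pos_iff.2 h0
    have : ‖u‖ * ‖u‖ ≤ (C * ‖w‖) * ‖u‖ := by nlinarith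
    exact le_of_mul_le_mul_right this hpos

/-- **§1 WITH THE CHAIN's LETTERS, STILL ABSTRACT**: generators `A_i = G_i ∘ q_i†` (`G_i` a «Green operator», `q_i` an «averaging»), the
reference coercivity given on the GRAM side (`κ₀‖x‖² ≤ ‖G₂(q₂†x)‖²`), and four letters `‖G₁y − G₂y‖ ≤ θ_G‖y‖`, `‖q₁v‖ ≤ M_Q‖v‖`,
`‖q₁v − q₂v‖ ≤ θ_Q‖v‖`, `‖G₂y‖ ≤ g‖y‖`: in the window `δ_A := θ_G M_Q + g θ_Q < √κ₀`,
`‖R₁v − R₂v‖ ≤ (δ_A∕(√κ₀ − δ_A) + δ_A∕√κ₀)‖v‖` (adjoint letters by `norm_adjoint_apply_le`, `s₂ = √κ₀`, `s₁ = √κ₀ − δ_A`). [folklore]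
[cite: Balaban1985BackgroundPropagators, (3.25) p.394, p.403, (3.63)–(3.68) pp.402–403] -/
theorem norm_starProjection_sub_le_of_letters (K₁ K₂ : Submodule 𝕜 E) [K₁.HasOrthogonalProjection] [K₂.HasOrthogonalProjection]
    (G₁ G₂ : E →ₗ[𝕜] E) (q₁ q₂ : E →ₗ[𝕜] F) {κ₀ θG MQ θQ g : ℝ} (hκ₀ : 0 < κ₀) (hθG : 0 ≤ θG) (hMQ : 0 ≤ MQ) (hθQ : 0 ≤ θQ)
    (hg : 0 ≤ g)
    (horth₁ : ∀ x, (G₁ ∘ₗ LinearMap.adjoint q₁) x ∈ K₁ᗮ) (horth₂ : ∀ x, (G₂ ∘ₗ LinearMap.adjoint q₂) x ∈ K₂ᗮ)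
    (hgen₁ : ∀ v, ∃ x, v - K₁.starProjection v = (G₁ ∘ₗ LinearMap.adjoint q₁) x)
    (hgen₂ : ∀ v, ∃ x, v - K₂.starProjection v = (G₂ ∘ₗ LinearMap.adjoint q₂) x)
    (hκ : ∀ x, κ₀ * ‖x‖ ^ 2 ≤ ‖G₂ (LinearMap.adjoint q₂ x)‖ ^ 2)
    (hG : ∀ y, ‖G₁ y - G₂ y‖ ≤ θG * ‖y‖) (hq₁ : ∀ v, ‖q₁ v‖ ≤ MQ * ‖v‖) (hdq : ∀ v, ‖q₁ v - q₂ v‖ ≤ θQ * ‖v‖)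
    (hG₂ : ∀ y, ‖G₂ y‖ ≤ g * ‖y‖) (hwin : θG * MQ + g * θQ < Real.sqrt κ₀) (v : E) :
    ‖K₁.starProjection v - K₂.starProjection v‖ ≤
      ((θG * MQ + g * θQ) / (Real.sqrt κ₀ - (θG * MQ + g * θQ)) + (θG * MQ + g * θQ) / Real.sqrt κ₀) * ‖v‖ := by
  have hδA0 : 0 ≤ θG * MQ + g * θQ := by positivity
  have hsκ : 0 < Real.sqrt κ₀ := Real.sqrt_pos.2 hκ₀
  have hs₁ : 0 < Real.sqrt κ₀ - (θG * MQ + g * θQ) := by linarith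
  -- the adjoint letters
  have hadj₁ : ∀ x, ‖LinearMap.adjoint q₁ x‖ ≤ MQ * ‖x‖ := norm_adjoint_apply_le q₁ hMQ hq₁
  have hadjd : ∀ x, ‖LinearMap.adjoint q₁ x - LinearMap.adjoint q₂ x‖ ≤ θQ * ‖x‖ := fun x => by
    have h := norm_adjoint_apply_le (q₁ - q₂) hθQ (fun v => by rw [LinearMap.sub_apply]; exact hdq v) x
    rwa [map_sub, LinearMap.sub_apply] at h
  -- `‖A₁x − A₂x‖ ≤ δ_A‖x‖`
  have hdiff : ∀ x, ‖(G₁ ∘ₗ LinearMap.adjoint q₁) x - (G₂ ∘ₗ LinearMap.adjoint q₂) x‖ ≤ (θG * MQ + g * θQ) * ‖x‖ := by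
    intro x
    rw [LinearMap.comp_apply, LinearMap.comp_apply]
    have e : G₁ (LinearMap.adjoint q₁ x) - G₂ (LinearMap.adjoint q₂ x) =
        (G₁ (LinearMap.adjoint q₁ x) - G₂ (LinearMap.adjoint q₁ x)) + G₂ (LinearMap.adjoint q₁ x - LinearMap.adjoint q₂ x) := by
      rw [map_sub]; abel
    rw [e]
    calc ‖(G₁ (LinearMap.adjoint q₁ x) - G₂ (LinearMap.adjoint q₁ x)) + G₂ (LinearMap.adjoint q₁ x - LinearMap.adjoint q₂ x)‖
        ≤ ‖G₁ (LinearMap.adjoint q₁ x) - G₂ (LinearMap.adjoint q₁ x)‖ + ‖G₂ (LinearMap.adjoint q₁ x - LinearMap.adjoint q₂ x)‖ :=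
          norm_add_le _ _
      _ ≤ θG * ‖LinearMap.adjoint q₁ x‖ + g * ‖LinearMap.adjoint q₁ x - LinearMap.adjoint q₂ x‖ := add_le_add (hG _) (hG₂ _)
      _ ≤ θG * (MQ * ‖x‖) + g * (θQ * ‖x‖) :=
          add_le_add (mul_le_mul_of_nonneg_left (hadj₁ x) hθG) (mul_le_mul_of_nonneg_left (hadjd x) hg)
      _ = (θG * MQ + g * θQ) * ‖x‖ := by ring
  have hdiff' : ∀ x, ‖(G₂ ∘ₗ LinearMap.adjoint q₂) x - (G₁ ∘ₗ LinearMap.adjoint q₁) x‖ ≤ (θG * MQ + g * θQ) * ‖x‖ := fun x => by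
    rw [norm_sub_rev]; exact hdiff x
  -- coercivity at the reference side, then at the other by nearness
  have hco₂ : ∀ x, Real.sqrt κ₀ * ‖x‖ ≤ ‖(G₂ ∘ₗ LinearMap.adjoint q₂) x‖ := sqrt_mul_norm_le _ hκ₀.le fun x => hκ x
  have hco₁ : ∀ x, (Real.sqrt κ₀ - (θG * MQ + g * θQ)) * ‖x‖ ≤ ‖(G₁ ∘ₗ LinearMap.adjoint q₁) x‖ :=
    coercive_of_near_map _ _ hco₂ hdiff'
  exact norm_starProjection_sub_le_of_generators K₁ K₂ _ _ hs₁ hsκ hδA0 horth₁ horth₂ hgen₁ hgen₂ hco₁ hco₂ hdiff v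

end Abstract

/-! ## §2 The chain's `R(U)`: `‖R(U)f − R(V)f‖ ≤ δ_A(1∕(√κ₀ − δ_A) + 1∕√κ₀)‖f‖`, `δ_A = θ_G M_Q + g θ_Q` — NO `κ⁻²`, NO Weyl window on `K′` -/

section Chain

variable {d : ℕ} (L : ℕ) [NeZero L] (m : Fin d → ℕ) {𝔸 : Type*} [Ring 𝔸] [Algebra ℂ 𝔸]
  {W : Type*} [NormedAddCommGroup W] [InnerProductSpace ℂ W] [FiniteDimensional ℂ W] (φ : W ≃ₗ[ℂ] 𝔸) (c₀ : ℝ) [Fact (0 < c₀)]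
  (η : ℝ) (U V : Bond d (fineP L m) → 𝔸ˣ) (c₁ : ℝ) [Fact (0 < c₁)] (a' : ℝ)
  (hRSU : ∀ (b : Bond d (fineP L m)) (v u : W), ⟪adTransportW φ U b v, u⟫_ℂ = ⟪v, adTransportW φ (fun b => (U b)⁻¹) b u⟫_ℂ)
  (hRSV : ∀ (b : Bond d (fineP L m)) (v u : W), ⟪adTransportW φ V b v, u⟫_ℂ = ⟪v, adTransportW φ (fun b => (V b)⁻¹) b u⟫_ℂ)
  (hposU : ∀ x : SiteL2K ℂ d (fineP L m) c₀ W, x ≠ 0 → 0 < RCLike.re ⟪x, laplacePrimeA L m φ η U a' (c₁ := c₁) x⟫_ℂ)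
  (hposV : ∀ x : SiteL2K ℂ d (fineP L m) c₀ W, x ≠ 0 → 0 < RCLike.re ⟪x, laplacePrimeA L m φ η V a' (c₁ := c₁) x⟫_ℂ)

include hRSU in
/-- **`G′(U)Q̃′(U)†x ⊥ Δ_U N(Q′(U))` and `f − R(U)f ∈ range(G′(U)Q̃′(U)†)`** — the two range facts of (3.25) for the chain's `R(U)` (S3a's
`inner_formula_rem_eq_zero` and `RofU_eq_formula`, read as the hypotheses `horth`∕`hgen` of §1). [cite: Balaban1985BackgroundPropagators, (3.21) p.394, (3.25) p.394] -/
theorem GQ_mem_orthogonal_and_gen :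
    (∀ x : SiteL2K ℂ d m c₁ W, (GpOfU L m φ η U a' (c₁ := c₁) hposU ∘ₗ
        LinearMap.adjoint ((WL2.linearEquiv ℂ ℂ (fun _ : TSite d m => c₁)).symm.toLinearMap ∘ₗ QprimeW L m φ U (c₀ := c₀))) x ∈
      ((LinearMap.ker (QprimeW L m φ U (c₀ := c₀))).map
        (covLaplaceSiteK ((η : ℂ))⁻¹ (adTransportW φ U) (adTransportW φ fun b => (U b)⁻¹)))ᗮ) ∧
    (∀ f : SiteL2K ℂ d (fineP L m) c₀ W, ∃ x : SiteL2K ℂ d m c₁ W, f - RofU L m φ η U (c₀ := c₀) f =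
      (GpOfU L m φ η U a' (c₁ := c₁) hposU ∘ₗ
        LinearMap.adjoint ((WL2.linearEquiv ℂ ℂ (fun _ : TSite d m => c₁)).symm.toLinearMap ∘ₗ QprimeW L m φ U (c₀ := c₀))) x) := by
  refine ⟨fun x => ?_, fun f => ?_⟩
  · rw [Submodule.mem_orthogonal]
    intro ω hω
    rw [inner_eq_zero_symm, LinearMap.comp_apply]
    have hker' : ∀ l : SiteL2K ℂ d (fineP L m) c₀ W, QprimeW L m φ U (c₀ := c₀) l = 0 →
        ((WL2.linearEquiv ℂ ℂ (fun _ : TSite d m => c₁)).symm.toLinearMap ∘ₗ QprimeW L m φ U (c₀ := c₀)) l = 0 := fun l hl => by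
      rw [LinearMap.comp_apply, hl, map_zero]
    exact inner_formula_rem_eq_zero (𝕜 := ℂ) _ (laplacePrimeA L m φ η U a' (c₁ := c₁)) (GpOfU L m φ η U a' (c₁ := c₁) hposU)
      (QprimeW L m φ U (c₀ := c₀)) ((WL2.linearEquiv ℂ ℂ (fun _ : TSite d m => c₁)).symm.toLinearMap ∘ₗ QprimeW L m φ U (c₀ := c₀))
      (LinearMap.adjoint ((WL2.linearEquiv ℂ ℂ (fun _ : TSite d m => c₁)).symm.toLinearMap ∘ₗ QprimeW L m φ U (c₀ := c₀)))
      hker' (fun l hl => laplacePrimeA_apply_of_ker L m φ η U a' hl) (laplacePrimeA_isSymmetric L m φ c₀ η U c₁ a' hRSU)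
      (fun x ψ => (LinearMap.adjoint_inner_right _ x ψ).symm) (fun x => apply_greenK hposU x) x ω hω
  · refine ⟨greenK _ (QGGQ_pos L m φ c₀ η U c₁ a' hRSU hposU)
      (((WL2.linearEquiv ℂ ℂ (fun _ : TSite d m => c₁)).symm.toLinearMap ∘ₗ QprimeW L m φ U (c₀ := c₀)) (GpOfU L m φ η U a' (c₁ := c₁) hposU f)), ?_⟩
    rw [RofU_eq_formula L m φ c₀ η U c₁ a' hRSU hposU f, sub_sub_cancel]
    rfl

include hRSU hRSV in
/-- **THE `κ^{−1∕2}` ROAD TO p. 403's «R(U) … SATISFY THE SAME BOUNDS»**: for two backgrounds `U`, `V` with mutually adjoint transporters and the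
displayed positivities of `Δ′_{a′}`, and FIVE letters — a coercivity `κ₀` of the Gram operator `K′(V) = Q̃′(V)G′(V)²Q̃′(V)†` at the REFERENCE background
`V` IN FORM (`hκ : ∀ ψ, κ₀‖ψ‖² ≤ re⟪ψ, K′(V)ψ⟫`), `‖G′(U)y − G′(V)y‖ ≤ θ_G‖y‖`, `‖Q̃′(U)v‖ ≤ M_Q‖v‖`, `‖Q̃′(U)v − Q̃′(V)v‖ ≤ θ_Q‖v‖`, `‖G′(V)y‖ ≤ g‖y‖` —
in the window `δ_A := θ_G M_Q + g θ_Q < √κ₀`:  **`‖R(U)f − R(V)f‖ ≤ (δ_A∕(√κ₀ − δ_A) + δ_A∕√κ₀)·‖f‖`.**  §1 at `K_i = Δ N(Q′)`, `A_i = G′Q̃′†`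
(`GQ_mem_orthogonal_and_gen`), `s_V = √κ₀` (`‖G′(V)Q̃′(V)†x‖² = re⟪x, K′(V)x⟫`, S3a's `inner_qggq_eq`), `s_U = √κ₀ − δ_A` (`coercive_of_near_map`),
adjoint letters by `norm_adjoint_apply_le`.  Compare S3d's `norm_RofU_sub_RofU_le` (`κ⁻²`, and a Weyl window `δ_K < κ₀` on `K′` itself). [cite: Balaban1985BackgroundPropagators, p.403, (3.25) p.394, (3.63)–(3.68) pp.402–403, Thm 3.11 p.416] -/
theorem norm_RofU_sub_RofU_le_sqrt {κ₀ θG MQ θQ g : ℝ} (hκ₀ : 0 < κ₀) (hθG : 0 ≤ θG) (hMQ : 0 ≤ MQ) (hθQ : 0 ≤ θQ) (hg : 0 ≤ g)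
    (hκ : ∀ ψ : SiteL2K ℂ d m c₁ W, κ₀ * ‖ψ‖ ^ 2 ≤ RCLike.re ⟪ψ,
      (((WL2.linearEquiv ℂ ℂ (fun _ : TSite d m => c₁)).symm.toLinearMap ∘ₗ QprimeW L m φ V (c₀ := c₀)) ∘ₗ
        GpOfU L m φ η V a' (c₁ := c₁) hposV ∘ₗ GpOfU L m φ η V a' (c₁ := c₁) hposV ∘ₗ
        LinearMap.adjoint ((WL2.linearEquiv ℂ ℂ (fun _ : TSite d m => c₁)).symm.toLinearMap ∘ₗ QprimeW L m φ V (c₀ := c₀))) ψ⟫_ℂ)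
    (hG : ∀ y, ‖GpOfU L m φ η U a' (c₁ := c₁) hposU y - GpOfU L m φ η V a' (c₁ := c₁) hposV y‖ ≤ θG * ‖y‖)
    (hQU : ∀ v, ‖((WL2.linearEquiv ℂ ℂ (fun _ : TSite d m => c₁)).symm.toLinearMap ∘ₗ QprimeW L m φ U (c₀ := c₀)) v‖ ≤ MQ * ‖v‖)
    (hdQ : ∀ v, ‖((WL2.linearEquiv ℂ ℂ (fun _ : TSite d m => c₁)).symm.toLinearMap ∘ₗ QprimeW L m φ U (c₀ := c₀)) v -
      ((WL2.linearEquiv ℂ ℂ (fun _ : TSite d m => c₁)).symm.toLinearMap ∘ₗ QprimeW L m φ V (c₀ := c₀)) v‖ ≤ θQ * ‖v‖)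
    (hGV : ∀ y, ‖GpOfU L m φ η V a' (c₁ := c₁) hposV y‖ ≤ g * ‖y‖)
    (hwin : θG * MQ + g * θQ < Real.sqrt κ₀) (f : SiteL2K ℂ d (fineP L m) c₀ W) :
    ‖RofU L m φ η U (c₀ := c₀) f - RofU L m φ η V (c₀ := c₀) f‖ ≤
      ((θG * MQ + g * θQ) / (Real.sqrt κ₀ - (θG * MQ + g * θQ)) + (θG * MQ + g * θQ) / Real.sqrt κ₀) * ‖f‖ := by
  haveI : CompleteSpace ((LinearMap.ker (QprimeW L m φ U (c₀ := c₀))).map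
      (covLaplaceSiteK ((η : ℂ))⁻¹ (adTransportW φ U) (adTransportW φ fun b => (U b)⁻¹))) := FiniteDimensional.complete ℂ _
  haveI : CompleteSpace ((LinearMap.ker (QprimeW L m φ V (c₀ := c₀))).map
      (covLaplaceSiteK ((η : ℂ))⁻¹ (adTransportW φ V) (adTransportW φ fun b => (V b)⁻¹))) := FiniteDimensional.complete ℂ _
  -- `R(U) = starProjection (Δ_U N(Q′(U)))` by definition
  have hRU : RofU L m φ η U (c₀ := c₀) f = ((LinearMap.ker (QprimeW L m φ U (c₀ := c₀))).map
      (covLaplaceSiteK ((η : ℂ))⁻¹ (adTransportW φ U) (adTransportW φ fun b => (U b)⁻¹))).starProjection f := by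
    unfold RofU B11Eq103H1Complex.RLatticeK projR; rfl
  have hRV : RofU L m φ η V (c₀ := c₀) f = ((LinearMap.ker (QprimeW L m φ V (c₀ := c₀))).map
      (covLaplaceSiteK ((η : ℂ))⁻¹ (adTransportW φ V) (adTransportW φ fun b => (V b)⁻¹))).starProjection f := by
    unfold RofU B11Eq103H1Complex.RLatticeK projR; rfl
  obtain ⟨horthU, hgenU⟩ := GQ_mem_orthogonal_and_gen L m φ c₀ η U c₁ a' hRSU hposU
  obtain ⟨horthV, hgenV⟩ := GQ_mem_orthogonal_and_gen L m φ c₀ η V c₁ a' hRSV hposV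
  -- the reference coercivity on the Gram side: `κ₀‖x‖² ≤ re⟪x, K′(V)x⟫ = ‖G′(V)Q̃′(V)†x‖²`
  have hκ' : ∀ x : SiteL2K ℂ d m c₁ W, κ₀ * ‖x‖ ^ 2 ≤ ‖GpOfU L m φ η V a' (c₁ := c₁) hposV
      (LinearMap.adjoint ((WL2.linearEquiv ℂ ℂ (fun _ : TSite d m => c₁)).symm.toLinearMap ∘ₗ QprimeW L m φ V (c₀ := c₀)) x)‖ ^ 2 := by
    intro x
    have h := hκ x
    have e := inner_qggq_eq ((WL2.linearEquiv ℂ ℂ (fun _ : TSite d m => c₁)).symm.toLinearMap ∘ₗ QprimeW L m φ V (c₀ := c₀))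
      (laplacePrimeA_isSymmetric L m φ c₀ η V c₁ a' hRSV) hposV x
    simp only [LinearMap.comp_apply] at h e
    unfold GpOfU at h ⊢
    rw [e, ← RCLike.ofReal_pow, RCLike.ofReal_re] at h
    exact h
  -- the range facts read at the `starProjection`
  have hgenU' : ∀ v, ∃ x : SiteL2K ℂ d m c₁ W, v - ((LinearMap.ker (QprimeW L m φ U (c₀ := c₀))).map
      (covLaplaceSiteK ((η : ℂ))⁻¹ (adTransportW φ U) (adTransportW φ fun b => (U b)⁻¹))).starProjection v =
      (GpOfU L m φ η U a' (c₁ := c₁) hposU ∘ₗ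
        LinearMap.adjoint ((WL2.linearEquiv ℂ ℂ (fun _ : TSite d m => c₁)).symm.toLinearMap ∘ₗ QprimeW L m φ U (c₀ := c₀))) x := by
    intro v
    obtain ⟨x, hx⟩ := hgenU v
    refine ⟨x, ?_⟩
    rw [← hx]
    unfold RofU B11Eq103H1Complex.RLatticeK projR; rfl
  have hgenV' : ∀ v, ∃ x : SiteL2K ℂ d m c₁ W, v - ((LinearMap.ker (QprimeW L m φ V (c₀ := c₀))).map
      (covLaplaceSiteK ((η : ℂ))⁻¹ (adTransportW φ V) (adTransportW φ fun b => (V b)⁻¹))).starProjection v =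
      (GpOfU L m φ η V a' (c₁ := c₁) hposV ∘ₗ
        LinearMap.adjoint ((WL2.linearEquiv ℂ ℂ (fun _ : TSite d m => c₁)).symm.toLinearMap ∘ₗ QprimeW L m φ V (c₀ := c₀))) x := by
    intro v
    obtain ⟨x, hx⟩ := hgenV v
    refine ⟨x, ?_⟩
    rw [← hx]
    unfold RofU B11Eq103H1Complex.RLatticeK projR; rfl
  rw [hRU, hRV]
  exact norm_starProjection_sub_le_of_letters _ _ _ _ _ _ hκ₀ hθG hMQ hθQ hg horthU horthV hgenU' hgenV' hκ' hG hQU hdQ hGV hwin f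

end Chain

end Literature.MathematicalPhysics.QuantumFieldTheory.Balaban1983to89.B9Eq325RLipschitzSqrt

end
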